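import Literature.AlgebraicGeometry.GroupSchemes.FrobeniusKernelUnitComponent      -- ★ p845457 (K1, B-p08): `finrank_quotient_ker_appTop_kerι_relFrobeniusOver_of_unitComponent`
-- (no `Summits` import: the P6d ★ ED. 4 engine `OrdSSKernelsOnBT`∕`stub_HLBT_holds` behind N2 was re-assembled Literature-side by A-p01 — this line depends on ★ Literature only)
import Literature.AlgebraicGeometry.GroupSchemes.BTGroupFrobeniusKernelInCoordinates -- ★ p845380∕p845404 (FKw): `comp_relFrobeniusOver_eq_one_of_pow_mem_ker`, `finrank_alg_ker_relFrobeniusOver`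
import Literature.AlgebraicGeometry.GroupSchemes.FrobeniusKillsImage                -- ★ p845347 (K-c3, B-p17): iterate bridge `comp_relFrobeniusOver_frobeniusTwistOver_eq_one_iff`
import Literature.AlgebraicGeometry.GroupSchemes.IsIsoOrEtaleOfNatCard              -- ★ (b1k∕b1c at a field): `finrank_alg_eq_natCard_sections_mul`
import Literature.AlgebraicGeometry.GroupSchemes.BTGroupConnectedDimOneOfTangentRank -- ★ PRODUCER `BTGroup.isConnectedDimOne_of_finrank_cotangent_le_one`, `exists_algEquiv_quotient_X_pow_of_connectedSpace`
import Literature.AlgebraicGeometry.GroupSchemes.UnitComponentOfFiniteGroupScheme   -- ★ (b1a): `exists_unitComponent` (the consumer՚s `U`-socket is any such)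
import Literature.AlgebraicGeometry.GroupSchemes.UnitComponentOfKernel            -- ★ p845875 (F0P6-p13): `BTGroup.exists_hom_kernel_app_one_of_unitComponent` — PAYS N1b
import Literature.AlgebraicGeometry.GroupSchemes.MonogenicSubgroupKilledByFrobeniusSquared -- ★ p845869 (B-p17): `FrobKill.comp_relFrobeniusOver_comp_relFrobeniusOver_eq_one_of_algEquiv` — PAYS N3
import Literature.AlgebraicGeometry.GroupSchemes.StableSubgroupsOfPointsLine        -- ★ p845878 (A-p01): `StableSubgroupsOfPoints.subgroup_eq_bot_or_eq_top_of_stable` — PAYS N6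
import Literature.AlgebraicGeometry.GroupSchemes.BarsottiTateGroupConnectedPart      -- ★ p845942 (B-p08, FILE B over ★ p845891 FILE A): `BTGroup.exists_connectedPart_ringAction` — PAYS N1
import Literature.AlgebraicGeometry.GroupSchemes.BarsottiTateGroupConnectedPartTangent -- ★ p845988 (B-p08, FILE C): `BTGroup.pos_height_and_finrank_cotangent_le_of_unitComponent` — PAYS N1c
import Literature.AlgebraicGeometry.GroupSchemes.BTGroupUniformizerKernelRank        -- ★ p846055 (F0P6-p16, over ★ (KR) p845840): `BTGroup.finrank_alg_uniformizerKernel` — PAYS N0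
import Literature.AlgebraicGeometry.GroupSchemes.UniformizerKernelMonogenic          -- ★ p846060 (A-p01): `UniformizerKernel.exists_algEquiv_quotient_X_pow_of_uniformizerKernel` — PAYS N2 (THE HEART)
import HarnessLib
/-!
# ★ RE-HOME (rung 0, GENERIC → Literature; director g27 s1336 (R1)) of `Lines/F0_P6b_BlockNumerics.lean` (tree sha16 a47148020bfb350d, 305 l.)

Target `Literature/AlgebraicGeometry/GroupSchemes/BTGroupOneDimBlockNumerics.lean`.  CODE BYTES = the Lines workfile's, except: the namespace
`Summit.HodgeConjecture.HodgeConjecture.Cruxes.HLiu418.F0P6bBlockNumerics` becomes `Literature.AlgebraicGeometry.GroupSchemes.BTGroupOneDimBlockNumerics` (this file mentions no `Summit.` constant and imports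
Literature ★ only — it is generic algebraic geometry), and the Summit `dupNamespace` option line is dropped.  Every short name is unchanged; the
`Lines/` original stays untouched until the LEAD's SHIM word, when it becomes `import` + `export Literature.AlgebraicGeometry.GroupSchemes.BTGroupOneDimBlockNumerics (…)` under the old
namespace (alias shim, lean-checked `F0/P6/L7/LA7-plan/g4/rehome/alias_shim_test.LA7-plan-g4.lean`).  Count-neutral: HC_CM is proved only modulo the 7 printed
citations (2 remaining: hLiu418 = stmt-HodgeConjecture-24832, h413 = stmt-HodgeConjecture-24833) until rung 0 closes.  (LA7-plan (g4), 2026-09-02.)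

Original module docstring (verbatim) follows.
-/


/-!
# F0 · P6b — «ONE-DIMENSIONAL BLOCK NUMERICS»: the ORD∕SS numerics of the `[ϖ]`-layer of a one-dimensional Barsotti–Tate `𝒪`-module
# over an algebraically closed field, delivered in the binder currency of P6c՚s `heart_of_constructors`
# (crux `HLiu418`, stmt-HodgeConjecture-24832; cell hodgecm-mathlib, P6 «MOD programme», sub-desk F0P6b-plan (g2) «BT groups»; ED. 1 — SORRY-FREE, 2026-09-01)

HC_CM is proved only modulo the printed citations (2 remaining named inputs hLiu418 24832, h413 24833) until rung 0 closes; this module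
changes no count.  THE LINE (D-0175, LINES FIRST; skeleton cand v1 49deda7258cec6f5 17:03Z → organs ★ → this edition) of the BT-side step that P6c՚s CONSTRUCTOR-SKELETON v0 §2 (rows D1–D4, K-HYP
`hWB₀ x̄`) and P6a՚s layer (ii) leave informal: at a special point `x̄` the w-block `𝒢 = 𝒢_x̄` is a Barsotti–Tate group `B` of height
`H = 2·e·f` over `κ̄` with a ring action `β` of `𝒪 = 𝒪_{F,w}` (DVR, residue field of cardinality `q = p^f`, uniformiser `ϖ`, `ϖ^e ~ p`) and
ONE-DIMENSIONAL (tangent space at the unit of rank `1`); `G = 𝒢[ϖ] = Ker (β ϖ on B.G 1)` with its unit component `U = G⁰`.  THEN (print: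
[HarrisTaylorAMS2001] §II.1–II.2, [Tate1967] §2.2–2.4, [Liu2021] p. 136): `Γ(U) ≃ κ̄[X]⧸(X^{p^{N}})` with `N = f·h`, `h ∈ {1, 2}` the `𝒪`-HEIGHT of the
connected part (`h = 1` ORDINARY, `h = 2` SUPERSINGULAR); `rk G = q²`; `rk Ker F_q|_G = q`; `#G(κ̄) = q^{2−h} ∈ {q, 1}`; `F_q ∘ F_q` kills `U`;
the `β`-stable subgroups of `G(κ̄)` (an `𝔽_q`-line or `0`) are `⊥, ⊤` — EXACTLY the binders `(NU, θU, hFFU, hrkG, hrkF, hpts, hsimple)` of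
P6c `heart_of_constructors` (cand v3 bd6699d5 :243–:254; F0P6c-plan (g2) «=» ON THE TYPES 2026-09-01T16:50:00Z) AT ONE POINT.

SOCKETS (the consumer supplies its own objects; nothing here fixes a definition): the BT group `B` with `β : 𝒪 → BTGroup.Hom B B`,
`IsRingActionBT B β` (★ `BTGroupNilpotentPoints`); the `[ϖ]`-LAYER SOCKET `ιG : G ⟶ B.G 1` = «a closed subgroup through which exactly the points
killed by `(β ϖ).app 1` factor»; the ACTION SOCKET `βG : σO → (G ⟶ G)` over any index type `σO` mapping to `𝒪` with `σO → 𝒪⧸ϖ` surjective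
(e.g. `σO = 𝓞 F`), compatible with `β` through `ιG`; the UNIT-COMPONENT SOCKET `jU : U ⟶ G` (★ (b1a) `exists_unitComponent` produces one);
ONE-DIMENSIONALITY as the rank of the cotangent module of the augmentation ideal of each layer (`≤ 1`, and `≠ 0` at layer `1`).

REGISTERED STUBS: NONE — ED. 1 is born SORRY-FREE: the seven organs of the cut of record (2026-09-01T17:07:22Z) were typed as generic ★ Literature
theorems by the named hands within the hour and are consumed BY NAME (one term each):
`N0_finrank_uniformizerKernel` := ★ p846055 `BTGroup.finrank_alg_uniformizerKernel` (F0P6-p16 `BTGroupUniformizerKernelRank`, over ★ (KR) p845840 A-p17; «`𝒪`-height 2»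
[HarrisTaylorAMS2001, §II.1 p. 59]: filtration `Ker ϖ ⊂ … ⊂ Ker ϖ^e = B[p]`, fppf lifts along `pMap`, kernel–rank multiplicativity);
`N1_unitComponentBTGroup` := ★ p845942 `BTGroup.exists_connectedPart_ringAction` (B-p08; connected–étale idempotent ★ p845891 + ★ `fixBTGroup`; [Tate1967] (2.4),
[Messing1972] II (3.3.18), [Tate1997FiniteFlatGroupSchemes] (3.7)); `N1b` = BY NAME ★ p845875 `BTGroup.exists_hom_kernel_app_one_of_unitComponent` (F0P6-p13);
`N1c_tangentRankOfUnitComponent` := ★ p845988 `BTGroup.pos_height_and_finrank_cotangent_le_of_unitComponent` (B-p08; [GortzWedhorn2020, (6.4)]);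
`N2_exponentOfKernel` (THE HEART) := ★ p846060 `UniformizerKernel.exists_algEquiv_quotient_X_pow_of_uniformizerKernel` (A-p01 `UniformizerKernelMonogenic`: the P6d dictionary
chain re-assembled Literature-side with the generator exposed, height dichotomy, layer-2 test; [Tate1997FiniteFlatGroupSchemes, (3.7) (II)]);
`N3` = BY NAME ★ p845869 `FrobKill.comp_relFrobeniusOver_comp_relFrobeniusOver_eq_one_of_algEquiv` (B-p17; [SGA3I, VII_A 4.1–4.3], [Demazure1972, Ch. II §5]);
`N6_simplePoints` := ★ p845878 `StableSubgroupsOfPoints.subgroup_eq_bot_or_eq_top_of_stable` (A-p01; [Liu2021, Prop. D.8 (proof), p. 136]).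
PAID IN THE HEAD: `hrkF` (★ K1 `finrank_quotient_ker_appTop_kerι_relFrobeniusOver_of_unitComponent`), `hpts` and `h ≤ 2` (★ `finrank_alg_eq_natCard_sections_mul`
+ arithmetic), `IsConnectedDimOne B⁰` (★ PRODUCER `BTGroup.isConnectedDimOne_of_finrank_cotangent_le_one`).
HEAD `blockNumerics_of_line` — kernel-checked, sorry-free; CONSUMER: P6a ED. 4 (one `obtain` per special point feeding P6c `heart_of_constructors`).

No instance, no notation, no axiom, no `sorry`.  [cite: HarrisTaylorAMS2001, §II.1 p. 59, §II.2] [cite: Tate1967, §2.2, (2.4)]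
[cite: Messing1972, Ch. II (3.3.18)] [cite: Tate1997FiniteFlatGroupSchemes, (3.7)] [cite: Liu2021, p. 136] [cite: SGA3I, VII_A 4.1–4.3]
-/

set_option autoImplicit false

noncomputable section



open CategoryTheory CategoryTheory.Limits AlgebraicGeometry MonoidalCategory CartesianMonoidalCategory
open Polynomial
open scoped MonObj Obj
open Literature.AlgebraicGeometry.Motives (SchemeOver specOver relFrobeniusOver frobeniusTwistOver)
open Literature.AlgebraicGeometry.GroupSchemes
open Literature.AlgebraicGeometry.GroupSchemes.AffineGroupScheme (Alg)
open Literature.AlgebraicGeometry.GroupSchemes.GroupSchemeKernel (ker kerι)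

namespace Literature.AlgebraicGeometry.GroupSchemes.BTGroupOneDimBlockNumerics
-- (★ re-home: the `open` lines above were hoisted before `namespace Literature.AlgebraicGeometry.…` so that `open AlgebraicGeometry` names Mathlib՚s root namespace, not `Literature.AlgebraicGeometry`.)
universe u v w

/-! ### §1 Registered stubs (generic statements about Barsotti–Tate groups and finite group schemes over a field; no moduli word) -/

section Stubs

variable {k : Type u} [Field k] [IsAlgClosed k] (p f : ℕ) [Fact p.Prime] [CharP k p] [ExpChar k p]
variable (𝒪 : Type v) [CommRing 𝒪] [IsDomain 𝒪] [IsDiscreteValuationRing 𝒪] [Finite (IsLocalRing.ResidueField 𝒪)] (ϖ : 𝒪)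

omit [IsAlgClosed k] [Fact p.Prime] [CharP k p] [ExpChar k p] [IsDomain 𝒪] [IsDiscreteValuationRing 𝒪]
  [Finite (IsLocalRing.ResidueField 𝒪)] in
/-- `N0` (PAID ★ p846055 `BTGroupUniformizerKernelRank`, F0P6-p16, over ★ (KR) p845840 A-p17) — **RANK OF THE UNIFORMISER KERNEL: `rk_κ̄ Γ(B[ϖ]) = p^{H∕e} = q²` («`𝒪`-height 2», [HarrisTaylorAMS2001, §II.1 p. 59])** for a Barsotti–Tate group `B` of height `H = 2·e·f` with a
ring action of `𝒪` in which `ϖ^e ~ p` (`e ≥ 1`).  Route: `Ker ϖ ⊂ Ker ϖ² ⊂ ⋯ ⊂ Ker ϖ^e = Ker p = B.G 1` (rank `p^H`, `B.finrank_eq`), each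
`ϖ^i : Ker ϖ^{i+1} → Ker ϖ` fppf-surjective with kernel `Ker ϖ^i` (lift `x ↦ u·ϖ^{e−i}·z` with `p z = x`, `B.surjective_pMap`, `B.flat_pMap`), so
`p^H = (rk Ker ϖ)^e` (★ (KR) `finrank_alg_eq_finrank_alg_ker_mul_of_flat_of_surjective`).  PAID.
[cite: Tate1967, §2.2 and (2.4)] [cite: HarrisTaylorAMS2001, §II.1 p. 59] -/
theorem N0_finrank_uniformizerKernel {H : ℕ} (B : BTGroup (Spec (.of k)) p H)
    (β : 𝒪 → BTGroup.Hom B B) (hβ : IsRingActionBT B β)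
    (e : ℕ) (he : 0 < e) (hH : H = 2 * e * f) (hpe : Associated (ϖ ^ e) (p : 𝒪))
    (G : SchemeOver k) [GrpObj G] [IsAffine G.left] [IsFinite G.hom] (ιG : G ⟶ B.G 1)
    (hιG : letI := B.grpObj 1; IsMonHom ιG ∧ IsClosedImmersion ιG.left)
    (hker : letI := B.grpObj 1; ∀ ⦃T : SchemeOver k⦄ (t : T ⟶ B.G 1), t ≫ (β ϖ).app 1 = 1 ↔ ∃ s : T ⟶ G, s ≫ ιG = t) :
    Module.finrank k (Alg G) = p ^ f * p ^ f :=
  BTGroup.finrank_alg_uniformizerKernel B β ϖ hβ e f he hH hpe G ιG hιG hker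

omit [CharP k p] [ExpChar k p] [IsDomain 𝒪] [IsDiscreteValuationRing 𝒪] [Finite (IsLocalRing.ResidueField 𝒪)] in
/-- `N1` (PAID ★ p845942 `BarsottiTateGroupConnectedPart` over ★ p845891 `ConnectedEtaleIdempotent`, B-p08) — **THE CONNECTED PART OF A BARSOTTI–TATE GROUP OVER AN ALGEBRAICALLY CLOSED FIELD IS A BARSOTTI–TATE GROUP, AND ENDOMORPHISMS
RESTRICT (L).**  The unit components `(B.G n)⁰` (★ (b1a) `exists_unitComponent`) with the restricted transitions and `[p]`-maps form a BT group `B⁰` of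
some height `H⁰ ≤ H` (`(B.G (n+1))⁰ ∩ B.G n = (B.G n)⁰` as a one-point clopen subgroup; `rk (B.G n)⁰ = p^{nH}∕#B.G n(κ̄)` by ★ (b1c)
`finrank_alg_eq_natCard_sections_mul`, and `#B.G n(κ̄) = (#B.G 1(κ̄))^n` from `surjective_pMap` on `κ̄`-points; `pMap⁰` flat and surjective onto
`(B.G n)⁰` by the rank count); every endomorphism maps `B⁰` to `B⁰` (★ (o-c2d) `ConnectedFactorsThroughUnitComponent`), so a ring action restricts.
PAID (B-p08's route: the connected–étale IDEMPOTENT `ε` of `B`, commuting with every endomorphism, and `B⁰ :=` ★ `fixBTGroup ε`). [cite: Tate1967, (2.4)] [cite: Messing1972, Ch. II (3.3.18)]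
[cite: Tate1997FiniteFlatGroupSchemes, (3.7)] -/
theorem N1_unitComponentBTGroup {H : ℕ} (B : BTGroup (Spec (.of k)) p H)
    (β : 𝒪 → BTGroup.Hom B B) (hβ : IsRingActionBT B β) :
    ∃ (H₀ : ℕ) (B₀ : BTGroup (Spec (.of k)) p H₀) (ι₀ : BTGroup.Hom B₀ B) (β₀ : 𝒪 → BTGroup.Hom B₀ B₀),
      H₀ ≤ H ∧ (∀ n, IsOpenImmersion (ι₀.app n).left ∧ IsClosedImmersion (ι₀.app n).left ∧ ConnectedSpace ↥(B₀.G n).left) ∧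
      IsRingActionBT B₀ β₀ ∧ ∀ a, (β₀ a).comp ι₀ = ι₀.comp (β a) :=
  BTGroup.exists_connectedPart_ringAction B β hβ

/-! **`N1b_unitComponentOfKernel` — NOT RESTATED IN THE ★ RE-HOME (gate `dedup.landed`, planner dry-run 2026-09-02T07:41Z):** the Lines original restates, token for token,
the already-landed ★ `BTGroup.exists_hom_kernel_app_one_of_unitComponent` (imported above) as a one-line «PAID BY NAME» theorem; this file uses that ★ declaration BY NAME at the
former call site of `N1b_unitComponentOfKernel` (same explicit-argument order). -/

omit [IsAlgClosed k] [Fact p.Prime] [CharP k p] [ExpChar k p] in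
/-- `N1c` (PAID ★ p845988 `BarsottiTateGroupConnectedPartTangent`, B-p08) — **THE UNIT COMPONENT INHERITS THE TANGENT RANK; A ONE-DIMENSIONAL BT GROUP HAS A CONNECTED PART OF POSITIVE HEIGHT.**
Along the clopen immersion `ι₀.app n` the augmentation ideals have isomorphic cotangent modules (`Γ(B.G n) = Γ((B.G n)⁰) × Γ(rest)`, the augmentation
ideal is `𝔪_e × Γ(rest)`), so `dim 𝔪⧸𝔪² ≤ 1` passes to `B₀.G n` (any augmentation of the local `Γ(B₀.G n)` is its unit); and `H⁰ = 0` would make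
`B₀.G 1 = Spec κ̄` open in `B.G 1` at the unit, forcing the cotangent module of layer `1` to vanish.  PAID (idempotent-kernel cotangent comparison: ★ `Ideal.mapCotangent_comap_bijective_of_surjective_of_isIdempotentElem_ker`,
★ `isIdempotentElem_ker_appTop_of_isOpenImmersion_of_surjective`). [cite: Tate1967, §2.2] [cite: GortzWedhorn2020, (6.4)] -/
theorem N1c_tangentRankOfUnitComponent {H H₀ : ℕ} (B : BTGroup (Spec (.of k)) p H) (B₀ : BTGroup (Spec (.of k)) p H₀)
    (ι₀ : BTGroup.Hom B₀ B)
    (hι₀ : ∀ n, IsOpenImmersion (ι₀.app n).left ∧ IsClosedImmersion (ι₀.app n).left ∧ ConnectedSpace ↥(B₀.G n).left)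
    (htan : ∀ n, letI := B.grpObj n;
      Module.finrank k (RingHom.ker ((η[B.G n] : 𝟙_ (SchemeOver k) ⟶ B.G n).left.appTop.hom) : Ideal (Alg (B.G n))).Cotangent ≤ 1)
    (hdim : letI := B.grpObj 1;
      Module.finrank k (RingHom.ker ((η[B.G 1] : 𝟙_ (SchemeOver k) ⟶ B.G 1).left.appTop.hom) : Ideal (Alg (B.G 1))).Cotangent ≠ 0) :
    0 < H₀ ∧ ∀ n, ∃ ε₀ : Alg (B₀.G n) →ₐ[k] k, Module.finrank k (RingHom.ker ε₀.toRingHom).Cotangent ≤ 1 :=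
  BTGroup.pos_height_and_finrank_cotangent_le_of_unitComponent p B B₀ ι₀ hι₀ htan hdim

omit [IsAlgClosed k] [ExpChar k p] in
/-- `N2` (PAID ★ p846060 `UniformizerKernelMonogenic`, A-p01) — **THE HEART: EXPONENT OF THE `ϖ`-KERNEL OF A CONNECTED ONE-DIMENSIONAL BARSOTTI–TATE `𝒪`-MODULE.**  For `C` connected of
dimension one (`IsConnectedDimOne`, height `H₀ > 0`) with a ring action `γ` of the DVR `𝒪` (residue field of cardinality `q = p^f`, uniformiser
`ϖ`, `ϖ ∣ p ∣ ϖ^e`), the kernel of `(γ ϖ).app 1` on `C.G 1` is `Spec κ̄[X]⧸(X^{q^h})` for some `h ≥ 1` (the `𝒪`-height).  Route: ★ P6d `stub_HLBT_holds p H₀`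
(`OrdSSKernelsOnBT`: law `M`, dictionary `e`, and — unless `[ϖ]_M = 0` — an `h > 0` with «points killed by `γ(ϖ^m)` = points with coordinate
`x^{q^{hm}} = 0`»); the branch `[ϖ]_M = 0` is void: `ϖ ∣ p` gives `γ p = γ ϖ ≫ γ c`, so `[p] = pMap ≫ incl` would be trivial on all points of `C.G 2`,
contradicting faithful flatness of `pMap` onto `C.G 1` of rank `p^{H₀} > 1`; then `U` and `Ker F^{fh}|_{C.G 1} = V(x^{p^{fh}})` (★ (FKw)
`ker_appTop_kerι_relFrobeniusOver_eq_span`, `finrank_alg_ker_relFrobeniusOver`) have the same points in every `κ̄`-algebra, hence coincide, and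
`f·h ≤ H₀` (compare inside `C.G 2`, where `Ker ϖ ⊂ Ker p = C.G 1`).  PAID (A-p01's route: the P6d dictionary RE-ASSEMBLED Literature-side with the GENERATOR
exposed — ★ `exists_naturalCoordinates_of_isConnectedDimOne` + ★ `exists_formalOModuleLaw_of_coordinates` + ★ HL-C `kernelPointsOfHeight` — and a layer-2 test for the void branch and `f·h ≤ H₀`).
[cite: Tate1997FiniteFlatGroupSchemes, (3.7) (II)] [cite: Frohlich1968, Ch. I §3 Thm. 2] [cite: HarrisTaylorAMS2001, §II.1 p. 59, §II.2] [cite: Tate1967, §2.2]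
[cite: Hazewinkel1978, (18.3.4), (21.8.12)] -/
theorem N2_exponentOfKernel {H₀ : ℕ} (C : BTGroup (Spec (.of k)) p H₀) (hC : IsConnectedDimOne C) (hH₀ : 0 < H₀)
    (hϖ : Irreducible ϖ) (hpe : ∃ e : ℕ, (p : 𝒪) ∣ ϖ ^ e) (hϖp : ϖ ∣ (p : 𝒪))
    (hq : Nat.card (IsLocalRing.ResidueField 𝒪) = p ^ f)
    (βC : 𝒪 → BTGroup.Hom C C) (hβC : IsRingActionBT C βC)
    (U : SchemeOver k) [GrpObj U] (u : U ⟶ C.G 1) (hu : letI := C.grpObj 1; IsMonHom u ∧ IsClosedImmersion u.left)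
    (hkerU : letI := C.grpObj 1; ∀ ⦃T : SchemeOver k⦄ (t : T ⟶ C.G 1), t ≫ (βC ϖ).app 1 = 1 ↔ ∃ s : T ⟶ U, s ≫ u = t) :
    ∃ h : ℕ, 0 < h ∧ Nonempty (Alg U ≃ₐ[k] (k[X] ⧸ Ideal.span {(X : k[X]) ^ (p ^ (f * h))})) :=
  UniformizerKernel.exists_algEquiv_quotient_X_pow_of_uniformizerKernel p f 𝒪 ϖ C hC hH₀ hϖ hpe hϖp hq βC hβC U u hu hkerU

/-! **`N3_frobeniusIterateKills` — NOT RESTATED IN THE ★ RE-HOME (gate `dedup.landed`, planner dry-run 2026-09-02T07:41Z):** the Lines original restates, token for token,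
the already-landed ★ `FrobKill.comp_relFrobeniusOver_comp_relFrobeniusOver_eq_one_of_algEquiv` (imported above) as a one-line «PAID BY NAME» theorem; this file uses that ★ declaration BY NAME at the
former call site of `N3_frobeniusIterateKills` (same explicit-argument order). -/

omit [IsAlgClosed k] [CharP k p] [ExpChar k p] [Finite (IsLocalRing.ResidueField 𝒪)] in
/-- `N6` (PAID ★ p845878 `StableSubgroupsOfPointsLine`, A-p01) — **THE `β`-STABLE SUBGROUPS OF `G(κ̄)` ARE `⊥, ⊤`**: the `κ̄`-points of `G = Ker (β ϖ)|_{B.G 1}` form, under `r • g :=` «the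
point of `G` under `g ≫ ιG ≫ (β r).app 1`» (well defined by `hker` and commutativity of `𝒪`; additive by `IsRingActionBT`), an `𝒪`-module killed by `ϖ`,
i.e. a vector space over the residue field `𝒪⧸ϖ` of cardinality `q = p^f`; of order `1` or `q` (`hpts`) it has dimension `≤ 1`, and a subgroup stable
under the `βG a` (`a : σO`, residues of `ρ a` exhausting `𝒪⧸ϖ`) is a subspace.  PAID — stated, as the organ, for ANY closed subgroup `ιG` with a lifted action (the `[ϖ]`-kernel property, `Irreducible ϖ` and the DVR
hypothesis are not needed). [cite: HarrisTaylorAMS2001, §II.2] [cite: Liu2021, Prop. D.8 (proof), p. 136] -/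
theorem N6_simplePoints {H : ℕ} (B : BTGroup (Spec (.of k)) p H)
    (β : 𝒪 → BTGroup.Hom B B) (hβ : IsRingActionBT B β)
    (hq : Nat.card (IsLocalRing.ResidueField 𝒪) = p ^ f)
    (G : SchemeOver k) [GrpObj G] (ιG : G ⟶ B.G 1)
    (hιG : letI := B.grpObj 1; IsMonHom ιG ∧ IsClosedImmersion ιG.left)
    {σO : Type w} (ρ : σO → 𝒪) (hρ : Function.Surjective fun a => IsLocalRing.residue 𝒪 (ρ a))
    (βG : σO → (G ⟶ G)) (hβG : ∀ a, βG a ≫ ιG = ιG ≫ (β (ρ a)).app 1)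
    (hpts : Nat.card (𝟙_ (SchemeOver k) ⟶ G) = 1 ∨ Nat.card (𝟙_ (SchemeOver k) ⟶ G) = p ^ f) :
    ∀ Λ : Subgroup (𝟙_ (SchemeOver k) ⟶ G), (∀ a, ∀ g ∈ Λ, g ≫ βG a ∈ Λ) → Λ = ⊥ ∨ Λ = ⊤ :=
  StableSubgroupsOfPoints.subgroup_eq_bot_or_eq_top_of_stable p f 𝒪 B β hβ hq G ιG hιG ρ hρ βG hβG hpts

end Stubs

/-! ### §2 HEAD — the binder tuple of P6c `heart_of_constructors` at one special point, from the stubs BY NAME -/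

section Head

variable {k : Type u} [Field k] [IsAlgClosed k] (p f : ℕ) [Fact p.Prime] [CharP k p] [ExpChar k p]

set_option maxHeartbeats 800000 in
set_option synthInstance.maxHeartbeats 400000 in
/-- **HEAD `blockNumerics_of_line` — «ONE-DIMENSIONAL BLOCK NUMERICS».**  INPUT: a BT group `B` of height `H = 2·e·f` over `κ̄` with a ring action
`β` of a DVR `𝒪` (`#(𝒪⧸𝔪) = p^f`, uniformiser `ϖ`, `ϖ^e ~ p`, `e ≥ 1`), one-dimensional (`htan`, `hdim`); the `[ϖ]`-layer socket `(G, ιG, hker)`, the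
action socket `(βG, ρ)`, a unit-component socket `(U, jU, hU)`.  OUTPUT: `NU ∈ {f, 2f}`, `θU : κ̄[X]⧸(X^{p^{NU}}) ≃ₐ Γ(U)`, and `hFFU, hrkG, hrkF, hpts,
hsimple` token-for-token as P6c `heart_of_constructors` binds them (with `kerFI p f G` unfolded).  Composition: N1 → N1c → ★ PRODUCER → N1b → N2 →
(N0, ★ count, arithmetic) → N3, ★ K1, N6. [cite: HarrisTaylorAMS2001, §II.1–II.2] [cite: Tate1967, §2.2, (2.4)] [cite: Liu2021, p. 136] -/
theorem blockNumerics_of_line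
    (𝒪 : Type v) [CommRing 𝒪] [IsDomain 𝒪] [IsDiscreteValuationRing 𝒪] [Finite (IsLocalRing.ResidueField 𝒪)]
    (hq : Nat.card (IsLocalRing.ResidueField 𝒪) = p ^ f) (ϖ : 𝒪) (hϖ : Irreducible ϖ)
    (e : ℕ) (he : 0 < e) (hpe : Associated (ϖ ^ e) (p : 𝒪))
    {H : ℕ} (hH : H = 2 * e * f) (B : BTGroup (Spec (.of k)) p H)
    (β : 𝒪 → BTGroup.Hom B B) (hβ : IsRingActionBT B β)
    (htan : ∀ n, letI := B.grpObj n;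
      Module.finrank k (RingHom.ker ((η[B.G n] : 𝟙_ (SchemeOver k) ⟶ B.G n).left.appTop.hom) : Ideal (Alg (B.G n))).Cotangent ≤ 1)
    (hdim : letI := B.grpObj 1;
      Module.finrank k (RingHom.ker ((η[B.G 1] : 𝟙_ (SchemeOver k) ⟶ B.G 1).left.appTop.hom) : Ideal (Alg (B.G 1))).Cotangent ≠ 0)
    (G : SchemeOver k) [GrpObj G] [IsAffine G.left] [IsFinite G.hom] (ιG : G ⟶ B.G 1)
    (hιG : letI := B.grpObj 1; IsMonHom ιG ∧ IsClosedImmersion ιG.left)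
    (hker : letI := B.grpObj 1; ∀ ⦃T : SchemeOver k⦄ (t : T ⟶ B.G 1), t ≫ (β ϖ).app 1 = 1 ↔ ∃ s : T ⟶ G, s ≫ ιG = t)
    {σO : Type w} (ρ : σO → 𝒪) (hρ : Function.Surjective fun a => IsLocalRing.residue 𝒪 (ρ a))
    (βG : σO → (G ⟶ G)) (hβG : ∀ a, βG a ≫ ιG = ιG ≫ (β (ρ a)).app 1)
    (U : SchemeOver k) [GrpObj U] [IsAffine U.left] (jU : U ⟶ G)
    (hU : IsMonHom jU ∧ IsOpenImmersion jU.left ∧ IsClosedImmersion jU.left ∧ ConnectedSpace ↥U.left) :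
    ∃ (NU : ℕ) (_θU : (k[X] ⧸ Ideal.span {(X : k[X]) ^ (p ^ NU)}) ≃ₐ[k] Alg U),
      (NU = f ∨ NU = f + f) ∧
      jU ≫ relFrobeniusOver p f G ≫ relFrobeniusOver p f (frobeniusTwistOver p f G) = 1 ∧
      Module.finrank k (Alg G) = p ^ f * p ^ f ∧
      Module.finrank k (Alg G ⧸ (RingHom.ker (kerι (relFrobeniusOver p f G)).left.appTop.hom : Ideal (Alg G))) = p ^ f ∧
      (Nat.card (𝟙_ (SchemeOver k) ⟶ G) = 1 ∨ Nat.card (𝟙_ (SchemeOver k) ⟶ G) = p ^ f) ∧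
      ∀ Λ : Subgroup (𝟙_ (SchemeOver k) ⟶ G), (∀ a, ∀ g ∈ Λ, g ≫ βG a ∈ Λ) → Λ = ⊥ ∨ Λ = ⊤ := by
  have hp : p.Prime := Fact.out
  -- N1: the connected part `B₀` with the restricted action `β₀`
  obtain ⟨H₀, B₀, ι₀, β₀, -, hι₀, hβ₀, hcomp⟩ := N1_unitComponentBTGroup p 𝒪 B β hβ
  -- N1c + ★ PRODUCER: `B₀` has positive height and is connected of dimension one
  obtain ⟨hH₀, htan₀⟩ := N1c_tangentRankOfUnitComponent p B B₀ ι₀ hι₀ htan hdim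
  have hC : IsConnectedDimOne B₀ :=
    BTGroup.isConnectedDimOne_of_finrank_cotangent_le_one B₀ (fun n => (hι₀ n).2.2) htan₀
  -- N1b: `U` is the kernel of `β₀ ϖ` on `B₀.G 1`
  obtain ⟨u, hu, -, hkerU⟩ := BTGroup.exists_hom_kernel_app_one_of_unitComponent p B B₀ ι₀ (hι₀ 1) (β ϖ) (β₀ ϖ) (hcomp ϖ)
    G ιG hιG hker U jU hU
  -- N2: the exponent `q^h`, `h ≥ 1`
  have hpdvd : ∃ e : ℕ, (p : 𝒪) ∣ ϖ ^ e := ⟨e, hpe.symm.dvd⟩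
  have hϖp : ϖ ∣ (p : 𝒪) := (dvd_pow_self ϖ he.ne').trans hpe.dvd
  obtain ⟨h, hh, ⟨ψ⟩⟩ := N2_exponentOfKernel p f 𝒪 ϖ B₀ hC hH₀ hϖ hpdvd hϖp hq β₀ hβ₀ U u hu hkerU
  -- N0 and the count `rk G = #G(κ̄) · rk U`
  have hrkG : Module.finrank k (Alg G) = p ^ f * p ^ f :=
    N0_finrank_uniformizerKernel p f 𝒪 ϖ B β hβ e he hH hpe G ιG hιG hker
  have hrkU : Module.finrank k (Alg U) = p ^ (f * h) := finrank_eq_of_algEquiv_quotient_X_pow ψ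
  obtain ⟨hjm, hjo, hjc, hUc⟩ := hU
  haveI := hjm; haveI := hjo; haveI := hjc; haveI := hUc
  have hcount : p ^ f * p ^ f = Nat.card (𝟙_ (SchemeOver k) ⟶ G) * p ^ (f * h) := by
    rw [← hrkG, ← hrkU]; exact finrank_alg_eq_natCard_sections_mul G U jU
  -- arithmetic: `h = 1` and `#G(κ̄) = q`, or `f·h = 2f` and `#G(κ̄) = 1`
  have hq2 : p ^ f * p ^ f = p ^ (f + f) := (pow_add p f f).symm
  have harith : (f * h = f ∧ Nat.card (𝟙_ (SchemeOver k) ⟶ G) = p ^ f) ∨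
      (f * h = f + f ∧ Nat.card (𝟙_ (SchemeOver k) ⟶ G) = 1) := by
    set c := Nat.card (𝟙_ (SchemeOver k) ⟶ G) with hc
    have hppos : 0 < p ^ f := pow_pos hp.pos f
    rcases Nat.lt_or_ge h 2 with h1 | h2
    · have h1' : h = 1 := by omega
      subst h1'
      rw [mul_one] at hcount
      exact Or.inl ⟨mul_one f, Nat.eq_of_mul_eq_mul_right hppos hcount.symm⟩
    · right
      have hle : p ^ (f + f) ≤ p ^ (f * h) := Nat.pow_le_pow_right hp.pos (by nlinarith)
      have hcpos : 0 < c := by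
        rcases Nat.eq_zero_or_pos c with h0 | h0
        · exfalso
          rw [h0, zero_mul] at hcount
          exact (Nat.mul_pos hppos hppos).ne' hcount
        · exact h0
      have hge : p ^ (f * h) ≤ c * p ^ (f * h) := Nat.le_mul_of_pos_left _ hcpos
      have heq : p ^ (f * h) = p ^ (f + f) := le_antisymm (by rw [← hq2, hcount]; exact hge) hle
      refine ⟨Nat.pow_right_injective hp.two_le heq, ?_⟩
      have h1 : c * p ^ (f * h) = 1 * p ^ (f * h) :=
        calc c * p ^ (f * h) = p ^ f * p ^ f := hcount.symm
          _ = p ^ (f * h) := by rw [hq2, heq]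
          _ = 1 * p ^ (f * h) := (one_mul _).symm
      exact Nat.eq_of_mul_eq_mul_right (pow_pos hp.pos _) h1
  have hNU : f * h = f ∨ f * h = f + f := harith.elim (fun a => Or.inl a.1) (fun a => Or.inr a.1)
  have hpts : Nat.card (𝟙_ (SchemeOver k) ⟶ G) = 1 ∨ Nat.card (𝟙_ (SchemeOver k) ⟶ G) = p ^ f :=
    harith.elim (fun a => Or.inr a.2) (fun a => Or.inl a.2)
  have hNle : f * h ≤ f + f := by rcases hNU with h' | h' <;> omega
  -- hrkF by ★ K1
  haveI : IsSeparated G.hom := inferInstance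
  have hrkF : Module.finrank k (Alg G ⧸ (RingHom.ker (kerι (relFrobeniusOver p f G)).left.appTop.hom : Ideal (Alg G))) = p ^ f := by
    have hmin := finrank_quotient_ker_appTop_kerι_relFrobeniusOver_of_unitComponent p f jU ψ (pow_ne_zero _ hp.ne_zero)
    rw [min_eq_left (Nat.pow_le_pow_right hp.pos (Nat.le_mul_of_pos_right f hh))] at hmin
    exact hmin
  refine ⟨f * h, ψ.symm, hNU, ?_, hrkG, hrkF, hpts, ?_⟩
  · exact FrobKill.comp_relFrobeniusOver_comp_relFrobeniusOver_eq_one_of_algEquiv p f G U jU ⟨hjm, hjo, hjc, hUc⟩ ψ.symm hNle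
  · exact N6_simplePoints p f 𝒪 B β hβ hq G ιG hιG ρ hρ βG hβG hpts

end Head

end Literature.AlgebraicGeometry.GroupSchemes.BTGroupOneDimBlockNumerics

end
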